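import Mathlib.Analysis.SpecialFunctions.Log.Deriv
import Mathlib.Analysis.Calculus.MeanValue
import Mathlib.Analysis.Calculus.Deriv.MeanValue
import HarnessLib

/-!
# The analytic core of THEOREM E — K1 = (ISO5) along the weight of one marked–Steiner edge (lane prim-rate, constants-miner 1, gen 16; CANDIDATES §GEN-16 R125–R131, BENCH l.177 M1-ISO5)

Support file for the closed crux `NoHeavyLowerTail` (stmt-CriticalPhenomena-4575), majority-gluing line, rows M1-SEP5 (l.137) /
M1-ISO5 (l.177).  THEOREM E of the lane (`prim-rate-mine-1/K1-PROOF.md`): for every finite weighted graph and every five marked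
points, `μ(⊥)^5 ≤ ∏_t μ(Iso_t)^2`.  Its proof varies the weight `w` of ONE marked–Steiner edge `e = t₀v`: along that line
`u(w) = μ(⊥) = A − w·B` and `r_t(w) = μ(Iso_t) = a_t − w·b_t` are AFFINE, the conditional pivotalities
`X_t(w) = (1 − w) b_t/(a_t − w b_t)`, `Y(w) = (1 − w) B/(A − w B)` are cluster-membership probabilities in the graph `G_w`, and the
van den Berg–Häggström–Kahn theorem (`Literature.Probability.Percolation.BHK2006_clusterConditionalPositiveAssociation_holds`)
gives `Σ_{t ≠ t₀} X_t(w) ≤ Y(w)` for every `w ∈ [0,1)` (LEMMA 2 of the proof file).  THIS FILE proves the purely real-variable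
consequence (LEMMAS 3–4 of the proof file): under that hypothesis the deficit
`F(w) = Σ_t log(a_t − w b_t) − (5/2)·log(A − w B)` is unimodal on `[0,1]`, hence `F(w) ≥ min (F 0) (F 1)` — deleting or
contracting the edge never both raise the deficit — and in particular `(ISO5)` at the two end points implies `(ISO5)` at every
`w ∈ [0,1]` (`iso5_line`).  The key step is the two-line quadratic lemma `quad5` («why five»: Cauchy–Schwarz over the four
non-`t₀` points meets the exponent `5/2` exactly).  The percolation bookkeeping (affinity, the identification of `X_t, Y`, the BHK
input, the deletion–contraction induction) is NOT formalised here.  No sorries, no named facts. [cite: Grimmett1999, §2.2]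
-/

noncomputable section

namespace Summit.CriticalPhenomena.PercolationContinuityZ3.Theorems

namespace HubOnly
namespace Refresh
namespace IsoFiveLine

open Real Finset Set

/-! ### LEMMA 3 — the quadratic lemma -/

/-- Cauchy–Schwarz for four numbers: `(Σ xᵢ)² ≤ 4·Σ xᵢ²`. [folklore] -/
theorem sq_sum_four_le (x : Fin 4 → ℝ) : (∑ i, x i) ^ 2 ≤ 4 * ∑ i, x i ^ 2 := by
  simp only [Fin.sum_univ_four]
  nlinarith [sq_nonneg (x 0 - x 1), sq_nonneg (x 0 - x 2), sq_nonneg (x 0 - x 3), sq_nonneg (x 1 - x 2),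
    sq_nonneg (x 1 - x 3), sq_nonneg (x 2 - x 3)]

/-- **LEMMA 3 («why five», x-form).**  If `x₀, x₁, …, x₄, y ≥ 0`, the four non-special values satisfy `Σ_{i≥1} xᵢ ≤ y`
(the BHK bound `σ ≤ 1`) and `Σ_t x_t > (5/2)·y` (the deficit is decreasing: `D > 5/2`), then `Σ_t x_t² > (5/2)·y²`
(so `D` is increasing: `ν < D`).  Proof: `Σ x_t² ≥ x₀² + s²/4` (`s = Σ_{i≥1} xᵢ`), `x₀ > (5/2)y − s ≥ 0`, and
`((5/2)y − s)² + s²/4 − (5/2)y² = (5/4)(y − s)(3y − s) ≥ 0`. [folklore] -/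
theorem quad5 (x : Fin 5 → ℝ) (y : ℝ) (hx : ∀ t, 0 ≤ x t) (hy : 0 ≤ y)
    (hσ : ∑ i : Fin 4, x i.succ ≤ y) (hD : (5 / 2 : ℝ) * y < ∑ t, x t) :
    (5 / 2 : ℝ) * y ^ 2 < ∑ t, x t ^ 2 := by
  rw [Fin.sum_univ_succ] at hD ⊢
  set s := ∑ i : Fin 4, x i.succ with hs
  have hs0 : 0 ≤ s := Finset.sum_nonneg fun i _ => hx i.succ
  have hcs : s ^ 2 ≤ 4 * ∑ i : Fin 4, x i.succ ^ 2 := sq_sum_four_le fun i => x i.succ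
  have h0 : (5 / 2 : ℝ) * y - s < x 0 := by linarith
  have h0' : 0 ≤ (5 / 2 : ℝ) * y - s := by linarith
  have hx0 : 0 ≤ x 0 := hx 0
  nlinarith [mul_nonneg (sub_nonneg.2 hσ) (by linarith : (0:ℝ) ≤ 3 * y - s),
    mul_lt_mul'' h0 h0 h0' h0']

/-- **LEMMA 3 (ratio form, for the record).**  `ρ_t ≥ 0`, `σ = ρ₁ + … + ρ₄ ≤ 1` and `Σ ρ_t² ≤ Σ ρ_t` (`ν ≥ D`) imply
`D = Σ ρ_t ≤ 5/2`; the equality case `(ρ₀; ρᵢ) = (3/2; 1/4, 1/4, 1/4, 1/4)` is the leading order of the lane's hub + satellite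
family (CANDIDATES R123), so the constant `5/2` of the method is sharp. [folklore] -/
theorem lemma3 (ρ : Fin 5 → ℝ) (hρ : ∀ t, 0 ≤ ρ t) (hσ : ∑ i : Fin 4, ρ i.succ ≤ 1)
    (hν : ∑ t, ρ t ^ 2 ≤ ∑ t, ρ t) : ∑ t, ρ t ≤ 5 / 2 := by
  rw [Fin.sum_univ_succ, Fin.sum_univ_succ (f := fun t => ρ t)] at hν
  rw [Fin.sum_univ_succ]
  set s := ∑ i : Fin 4, ρ i.succ with hs
  have hs0 : 0 ≤ s := Finset.sum_nonneg fun i _ => hρ i.succ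
  have hcs : s ^ 2 ≤ 4 * ∑ i : Fin 4, ρ i.succ ^ 2 := sq_sum_four_le fun i => ρ i.succ
  have hρ0 : 0 ≤ ρ 0 := hρ 0
  by_contra h
  push Not at h
  nlinarith [mul_nonneg (sub_nonneg.2 hσ) (by linarith : (0:ℝ) ≤ 2 * (ρ 0 + s) - 5 / 4 - 5 / 4 * s)]

/-! ### The line: definitions and derivatives -/

/-! Notation of the docstrings (the statements spell the functions out, so that the file declares no definitions):
`F(w) := Σ_t log (a_t − w b_t) − (5/2)·log (A − w B)` (the ISO5 deficit along the line, `r_t(w) = a_t − w b_t`, `u(w) = A − w B`),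
`g(w) := Σ_t b_t/(a_t − w b_t) − (5/2)·B/(A − w B)` (`= −F′(w) = y(w)·(D(w) − 5/2)`),
`g′(w) := Σ_t (b_t/(a_t − w b_t))² − (5/2)·(B/(A − w B))²` (`= dg/dw`). -/

variable {a b : Fin 5 → ℝ} {A B : ℝ}

/-! Standing hypotheses of the line (written out in every statement): `0 ≤ b_t < a_t` (so `r_t(1) > 0`) and
`0 ≤ B < A` (so `u(1) > 0`). -/

/-- Positivity of the affine functions `r_t(w) = a_t − w b_t` for `w ≤ 1`. [folklore] -/
theorem pos_t (hb : ∀ t, 0 ≤ b t) (hab : ∀ t, b t < a t) (t : Fin 5) {w : ℝ} (hw : w ≤ 1) :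
    0 < a t - w * b t := by
  have := hab t
  nlinarith [hb t]

/-- Positivity of `u(w) = A − w B` for `w ≤ 1`. [folklore] -/
theorem pos (hB : 0 ≤ B) (hAB : B < A) {w : ℝ} (hw : w ≤ 1) : 0 < A - w * B := by
  nlinarith

/-- `F` has derivative `−g` at every `w ≤ 1`. -/
theorem hasDerivAt_F (hb : ∀ t, 0 ≤ b t) (hab : ∀ t, b t < a t) (hB : 0 ≤ B) (hAB : B < A) {w : ℝ} (hw : w ≤ 1) :
    HasDerivAt ((fun w : ℝ => ∑ t, Real.log (a t - w * b t) - (5 / 2) * Real.log (A - w * B))) (-((fun w : ℝ => ∑ t, b t / (a t - w * b t) - (5 / 2) * (B / (A - w * B))) w)) w := by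
  have hlin : ∀ c d : ℝ, HasDerivAt (fun w : ℝ => c - w * d) (-(1 * d)) w := fun c d =>
    ((hasDerivAt_id' w).mul_const d).const_sub c
  have hsum : HasDerivAt (fun w => ∑ t, Real.log (a t - w * b t)) (∑ t, (-(1 * b t)) / (a t - w * b t)) w := by
    apply HasDerivAt.fun_sum
    intro t _
    exact (hlin (a t) (b t)).log (ne_of_gt (pos_t hb hab t hw))
  have hu : HasDerivAt (fun w => (5 / 2 : ℝ) * Real.log (A - w * B)) ((5 / 2) * ((-(1 * B)) / (A - w * B))) w :=
    ((hlin A B).log (ne_of_gt (pos hB hAB hw))).const_mul _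
  have key : HasDerivAt ((fun w : ℝ => ∑ t, Real.log (a t - w * b t) - (5 / 2) * Real.log (A - w * B)))
      ((∑ t, (-(1 * b t)) / (a t - w * b t)) - (5 / 2) * ((-(1 * B)) / (A - w * B))) w := hsum.fun_sub hu
  refine key.congr_deriv ?_
  simp only [one_mul, neg_div, Finset.sum_neg_distrib]
  ring

/-- `g` has derivative `g'` at every `w ≤ 1`. -/
theorem hasDerivAt_g (hb : ∀ t, 0 ≤ b t) (hab : ∀ t, b t < a t) (hB : 0 ≤ B) (hAB : B < A) {w : ℝ} (hw : w ≤ 1) :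
    HasDerivAt ((fun w : ℝ => ∑ t, b t / (a t - w * b t) - (5 / 2) * (B / (A - w * B)))) ((fun w : ℝ => ∑ t, (b t / (a t - w * b t)) ^ 2 - (5 / 2) * (B / (A - w * B)) ^ 2) w) w := by
  have hlin : ∀ c d : ℝ, HasDerivAt (fun w : ℝ => c - w * d) (-(1 * d)) w := fun c d =>
    ((hasDerivAt_id' w).mul_const d).const_sub c
  have hquot : ∀ c d : ℝ, 0 < c - w * d →
      HasDerivAt (fun w : ℝ => d / (c - w * d)) ((d / (c - w * d)) ^ 2) w := by
    intro c d hcd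
    have := (hasDerivAt_const w d).div (hlin c d) (ne_of_gt hcd)
    refine this.congr_deriv ?_
    rw [div_pow]
    ring
  have hsum : HasDerivAt (fun w => ∑ t, b t / (a t - w * b t)) (∑ t, (b t / (a t - w * b t)) ^ 2) w := by
    apply HasDerivAt.fun_sum
    intro t _
    exact hquot (a t) (b t) (pos_t hb hab t hw)
  have hu : HasDerivAt (fun w => (5 / 2 : ℝ) * (B / (A - w * B))) ((5 / 2) * (B / (A - w * B)) ^ 2) w :=
    (hquot A B (pos hB hAB hw)).const_mul _
  exact hsum.fun_sub hu

/-- `F` is continuous on `[0,1]`. -/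
theorem continuousOn_F (hb : ∀ t, 0 ≤ b t) (hab : ∀ t, b t < a t) (hB : 0 ≤ B) (hAB : B < A) : ContinuousOn ((fun w : ℝ => ∑ t, Real.log (a t - w * b t) - (5 / 2) * Real.log (A - w * B))) (Icc 0 1) :=
  fun _ hw => (hasDerivAt_F hb hab hB hAB hw.2).continuousAt.continuousWithinAt

/-- `g` is continuous on `[0,1]`. -/
theorem continuousOn_g (hb : ∀ t, 0 ≤ b t) (hab : ∀ t, b t < a t) (hB : 0 ≤ B) (hAB : B < A) : ContinuousOn ((fun w : ℝ => ∑ t, b t / (a t - w * b t) - (5 / 2) * (B / (A - w * B)))) (Icc 0 1) :=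
  fun _ hw => (hasDerivAt_g hb hab hB hAB hw.2).continuousAt.continuousWithinAt

/-! ### LEMMA 4 — the up-set argument and unimodality -/

/-! The BHK hypothesis along the line (LEMMA 2 of the proof file, in slope form), written out in every statement as `hσ`:
for every `w ∈ [0,1)`, `Σ_{t ≠ 0} b_t/(a_t − w b_t) ≤ B/(A − w B)`, i.e. `Σ_{i ≥ 1} X_i(w) ≤ Y(w)` after division by `1 − w`. -/

/-- At a point of `[0,1)` where the deficit is decreasing (`g > 0`, i.e. `D > 5/2`) it is strictly convex-from-below in the
sense `g' > 0` (i.e. `D` is increasing): LEMMA 3 applied to `x_t = b_t/(a_t − w b_t)`, `y = B/(A − w B)`. -/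
theorem g'_pos_of_g_pos (hb : ∀ t, 0 ≤ b t) (hab : ∀ t, b t < a t) (hB : 0 ≤ B) (hAB : B < A)
    (hσ : ∀ w ∈ Ico (0 : ℝ) 1, ∑ i : Fin 4, b i.succ / (a i.succ - w * b i.succ) ≤ B / (A - w * B)) {w : ℝ} (hw : w ∈ Ico (0 : ℝ) 1)
    (hg : 0 < (fun w : ℝ => ∑ t, b t / (a t - w * b t) - (5 / 2) * (B / (A - w * B))) w) : 0 < (fun w : ℝ => ∑ t, (b t / (a t - w * b t)) ^ 2 - (5 / 2) * (B / (A - w * B)) ^ 2) w := by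
  have hw1 : w ≤ 1 := le_of_lt hw.2
  set x : Fin 5 → ℝ := fun t => b t / (a t - w * b t) with hx
  set y : ℝ := B / (A - w * B) with hy
  have hx0 : ∀ t, 0 ≤ x t := fun t => div_nonneg (hb t) (le_of_lt (pos_t hb hab t hw1))
  have hy0 : 0 ≤ y := div_nonneg hB (le_of_lt (pos hB hAB hw1))
  have hσ' : ∑ i : Fin 4, x i.succ ≤ y := hσ w hw
  have hD : (5 / 2 : ℝ) * y < ∑ t, x t := by
    have : (fun w : ℝ => ∑ t, b t / (a t - w * b t) - (5 / 2) * (B / (A - w * B))) w = ∑ t, x t - (5 / 2) * y := rfl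
    linarith
  have key := quad5 x y hx0 hy0 hσ' hD
  have : (fun w : ℝ => ∑ t, (b t / (a t - w * b t)) ^ 2 - (5 / 2) * (B / (A - w * B)) ^ 2) w = ∑ t, x t ^ 2 - (5 / 2) * y ^ 2 := rfl
  linarith

/-- **The up-set lemma.**  If the deficit is strictly decreasing at some `w₀ ∈ [0,1)` (`g(w₀) > 0`), it stays so on
`[w₀, 1]`: `g(w) ≥ g(w₀) > 0`.  (Fencing argument: the constant `g(w₀)` is a lower fence for `g`, because wherever
`g = g(w₀) > 0` we have `g' > 0`.) -/
theorem g_ge_of_g_pos (hb : ∀ t, 0 ≤ b t) (hab : ∀ t, b t < a t) (hB : 0 ≤ B) (hAB : B < A)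
    (hσ : ∀ w ∈ Ico (0 : ℝ) 1, ∑ i : Fin 4, b i.succ / (a i.succ - w * b i.succ) ≤ B / (A - w * B)) {w₀ : ℝ} (hw₀ : w₀ ∈ Ico (0 : ℝ) 1)
    (hg : 0 < (fun w : ℝ => ∑ t, b t / (a t - w * b t) - (5 / 2) * (B / (A - w * B))) w₀) : ∀ w ∈ Icc w₀ 1, (fun w : ℝ => ∑ t, b t / (a t - w * b t) - (5 / 2) * (B / (A - w * B))) w₀ ≤ (fun w : ℝ => ∑ t, b t / (a t - w * b t) - (5 / 2) * (B / (A - w * B))) w := by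
  intro w hw
  have hcont : ContinuousOn ((fun w : ℝ => ∑ t, b t / (a t - w * b t) - (5 / 2) * (B / (A - w * B)))) (Icc w₀ 1) :=
    (continuousOn_g hb hab hB hAB).mono (Icc_subset_Icc hw₀.1 le_rfl)
  refine image_le_of_deriv_right_lt_deriv_boundary' (f := fun _ => (fun w : ℝ => ∑ t, b t / (a t - w * b t) - (5 / 2) * (B / (A - w * B))) w₀) (f' := fun _ => 0)
    (B := (fun w : ℝ => ∑ t, b t / (a t - w * b t) - (5 / 2) * (B / (A - w * B)))) (B' := (fun w : ℝ => ∑ t, (b t / (a t - w * b t)) ^ 2 - (5 / 2) * (B / (A - w * B)) ^ 2)) continuousOn_const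
    (fun x _ => (hasDerivAt_const x _).hasDerivWithinAt) le_rfl hcont
    (fun x hx => (hasDerivAt_g hb hab hB hAB (le_of_lt hx.2)).hasDerivWithinAt) ?_ hw
  intro x hx hfx
  have hx' : x ∈ Ico (0 : ℝ) 1 := ⟨hw₀.1.trans hx.1, hx.2⟩
  have : 0 < (fun w : ℝ => ∑ t, b t / (a t - w * b t) - (5 / 2) * (B / (A - w * B))) x := by
    simp only at hfx ⊢; rw [← hfx]; exact hg
  exact g'_pos_of_g_pos hb hab hB hAB hσ hx' this

/-- **LEMMA 4 (unimodality ⟹ (QC_e) for a marked–Steiner edge).**  Under the BHK hypothesis `hσ` (`Σ_{i≥1} X_i ≤ Y` along the line), the ISO5 deficit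
along the line satisfies `F(w) ≥ min (F 0) (F 1)` for every `w ∈ [0,1]`: deleting (`w = 0`) or contracting (`w = 1`) the edge
never both raise the deficit above an interior value. -/
theorem F_ge_min (hb : ∀ t, 0 ≤ b t) (hab : ∀ t, b t < a t) (hB : 0 ≤ B) (hAB : B < A)
    (hσ : ∀ w ∈ Ico (0 : ℝ) 1, ∑ i : Fin 4, b i.succ / (a i.succ - w * b i.succ) ≤ B / (A - w * B)) {w : ℝ} (hw : w ∈ Icc (0 : ℝ) 1) :
    min ((fun w : ℝ => ∑ t, Real.log (a t - w * b t) - (5 / 2) * Real.log (A - w * B)) 0) ((fun w : ℝ => ∑ t, Real.log (a t - w * b t) - (5 / 2) * Real.log (A - w * B)) 1) ≤ (fun w : ℝ => ∑ t, Real.log (a t - w * b t) - (5 / 2) * Real.log (A - w * B)) w := by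
  by_cases hcase : ∃ w₀ ∈ Ico (0 : ℝ) w, 0 < (fun w : ℝ => ∑ t, b t / (a t - w * b t) - (5 / 2) * (B / (A - w * B))) w₀
  · -- the deficit is decreasing from `w₀` on, in particular on `[w, 1]`: `F w ≥ F 1`
    obtain ⟨w₀, hw₀, hg⟩ := hcase
    have hw₀' : w₀ ∈ Ico (0 : ℝ) 1 := ⟨hw₀.1, lt_of_lt_of_le hw₀.2 hw.2⟩
    have hanti : AntitoneOn ((fun w : ℝ => ∑ t, Real.log (a t - w * b t) - (5 / 2) * Real.log (A - w * B))) (Icc w 1) := by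
      apply antitoneOn_of_hasDerivWithinAt_nonpos (convex_Icc w 1) ((continuousOn_F hb hab hB hAB).mono (Icc_subset_Icc hw.1 le_rfl))
        (f' := fun x => -((fun w : ℝ => ∑ t, b t / (a t - w * b t) - (5 / 2) * (B / (A - w * B))) x))
      · intro x hx
        rw [interior_Icc] at hx
        exact (hasDerivAt_F hb hab hB hAB (le_of_lt hx.2)).hasDerivWithinAt
      · intro x hx
        rw [interior_Icc] at hx
        have := g_ge_of_g_pos hb hab hB hAB hσ hw₀' hg x ⟨le_of_lt (lt_trans hw₀.2 hx.1), le_of_lt hx.2⟩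
        linarith
    have := hanti ⟨le_rfl, hw.2⟩ ⟨hw.2, le_rfl⟩ hw.2
    exact le_trans (min_le_right _ _) this
  · -- the deficit is non-decreasing on `[0, w]`: `F w ≥ F 0`
    push Not at hcase
    have hmono : MonotoneOn ((fun w : ℝ => ∑ t, Real.log (a t - w * b t) - (5 / 2) * Real.log (A - w * B))) (Icc 0 w) := by
      apply monotoneOn_of_hasDerivWithinAt_nonneg (convex_Icc 0 w) ((continuousOn_F hb hab hB hAB).mono (Icc_subset_Icc le_rfl hw.2))
        (f' := fun x => -((fun w : ℝ => ∑ t, b t / (a t - w * b t) - (5 / 2) * (B / (A - w * B))) x))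
      · intro x hx
        rw [interior_Icc] at hx
        exact (hasDerivAt_F hb hab hB hAB (le_trans (le_of_lt hx.2) hw.2)).hasDerivWithinAt
      · intro x hx
        rw [interior_Icc] at hx
        have := hcase x ⟨le_of_lt hx.1, hx.2⟩
        linarith
    have := hmono ⟨le_rfl, hw.1⟩ ⟨hw.1, le_rfl⟩ hw.1
    exact le_trans (min_le_left _ _) this

/-! ### The multiplicative corollary: (ISO5) propagates from the end points to the whole line -/

/-- `F(w) ≥ 0` is `(ISO5)` at `w`: `u(w)^5 ≤ (∏_t r_t(w))^2`. -/
theorem F_nonneg_iff (hb : ∀ t, 0 ≤ b t) (hab : ∀ t, b t < a t) (hB : 0 ≤ B) (hAB : B < A) {w : ℝ} (hw : w ≤ 1) :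
    0 ≤ (fun w : ℝ => ∑ t, Real.log (a t - w * b t) - (5 / 2) * Real.log (A - w * B)) w ↔ (A - w * B) ^ 5 ≤ (∏ t, (a t - w * b t)) ^ 2 := by
  have hu : 0 < A - w * B := pos hB hAB hw
  have hr : ∀ t, 0 < a t - w * b t := fun t => pos_t hb hab t hw
  have hprod : 0 < ∏ t, (a t - w * b t) := Finset.prod_pos fun t _ => hr t
  rw [← Real.log_le_log_iff (pow_pos hu 5) (pow_pos hprod 2), Real.log_pow, Real.log_pow,
    Real.log_prod (s := Finset.univ) (f := fun t => a t - w * b t) (fun t _ => ne_of_gt (hr t))]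
  constructor
  · intro hF; push_cast; linarith
  · intro hF; push_cast at hF; linarith

/-- **(ISO5) along a marked–Steiner line.**  If `u^5 ≤ (∏ r_t)^2` holds for the edge deleted (`w = 0`: `A^5 ≤ (∏ a_t)^2`) and
for the edge contracted (`w = 1`: `(A − B)^5 ≤ (∏ (a_t − b_t))^2`), and the BHK bound `hσ` holds along the line, then
`(A − w B)^5 ≤ (∏_t (a_t − w b_t))^2` for every `w ∈ [0,1]` — the induction step of THEOREM D′ / THEOREM E. -/
theorem iso5_line (hb : ∀ t, 0 ≤ b t) (hab : ∀ t, b t < a t) (hB : 0 ≤ B) (hAB : B < A)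
    (hσ : ∀ w ∈ Ico (0 : ℝ) 1, ∑ i : Fin 4, b i.succ / (a i.succ - w * b i.succ) ≤ B / (A - w * B))
    (h0 : A ^ 5 ≤ (∏ t, a t) ^ 2) (h1 : (A - B) ^ 5 ≤ (∏ t, (a t - b t)) ^ 2)
    {w : ℝ} (hw : w ∈ Icc (0 : ℝ) 1) : (A - w * B) ^ 5 ≤ (∏ t, (a t - w * b t)) ^ 2 := by
  rw [← F_nonneg_iff hb hab hB hAB hw.2]
  have hF0 : 0 ≤ (fun w : ℝ => ∑ t, Real.log (a t - w * b t) - (5 / 2) * Real.log (A - w * B)) 0 := by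
    rw [F_nonneg_iff hb hab hB hAB zero_le_one]
    simpa using h0
  have hF1 : 0 ≤ (fun w : ℝ => ∑ t, Real.log (a t - w * b t) - (5 / 2) * Real.log (A - w * B)) 1 := by
    rw [F_nonneg_iff hb hab hB hAB le_rfl]
    simpa using h1
  exact le_trans (le_min hF0 hF1) (F_ge_min hb hab hB hAB hσ hw)

end IsoFiveLine
end Refresh
end HubOnly
end Summit.CriticalPhenomena.PercolationContinuityZ3.Theorems
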